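/-
Copyright (c) 2026 the pub-hodgecm-mathlib formalisation cell (harness21).  Prover seat hodgecm-mathlib-K2E1-p13 (g2), Track B ∕ K2-LIT, h413 = `stmt-HodgeConjecture-24833`,
line `K2_E1_TraceFormulaBeta`, ROADCARD «5Res ENDGAME BY FAMILIES» (dealer K2E1-plan (g7) (232)): (S) χ-sections under the Galois twist and (H3) the REALITY `conj ∘ φ = φ ∘ c_G` of the
normalised sections of a self-dual unitary `χ` at a `c_G`-stable level — the payer of the letters `hreal`, `hreal′` of ★ `K2E1ChiScatteringConjSymmetryTubeU2`, modulo (K).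
-/
import Summits.HodgeConjecture.HodgeConjecture.Theorems.K2E1QuasiSplitGaloisTwistU2        -- ★ (H2) FILE 1 p860213 (this seat): `coe_adelicVal_galTwist`, `galTwist_mem_borelAdelic_iff`
import Summits.HodgeConjecture.HodgeConjecture.Theorems.K2E1CharacterEisensteinU2Defs        -- ★ p859441 (K2-defs1): `IsChiSection`, `firstEntryUnit`, `reflectChar`, `reflectChar_apply`
import HarnessLib

/-!
# `K2E1ChiSectionGaloisTwistU2` — (S) `χ`-SECTIONS UNDER THE GALOIS TWIST, (H3) THE REALITY `conj ∘ φ = φ ∘ c_G` OF NORMALISED SELF-DUAL SECTIONS (modulo the `K`-stability letter (K))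

Track B ∕ K2-LIT, crux h413 = `stmt-HodgeConjecture-24833`, route of record `HCCMUnconditional`; cell `hodgecm-mathlib`, squad K2, ENGINE E1.  THEOREMS ONLY (no `def`, no `instance`,
no `notation`, no `sorry`; default heartbeats); lane `--supports stmt-HodgeConjecture-24833 --as helper` (count-neutral).  Rank-generic `(F, E, c, N)`, hypothesis-first on `(cG, hcG)`.

THE MATHEMATICS ([MoeglinWaldspurger1995, I.2.17, II.1.7]; [GelbartRogawski1991, §3.1]).  (S1) the first diagonal entry is twisted: `(c_G b)₀₀ = (c ⊗ 1)(b₀₀)`; (S2) hence a `χ`-section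
`φ` (`φ(bg) = χ(b₀₀)φ(g)`) is carried by `c_G` to a section with the TWISTED equivariance `φ(c_G(bg)) = χ((c⊗1) b₀₀)·φ(c_G g)`; (S3) for a SELF-DUAL `χ` (★ `reflectChar c χ = χ`, i.e.
`χ((c⊗1)a)⁻¹ = χ(a)`) which is UNITARY, `χ((c⊗1)a) = χ(a)⁻¹ = conj χ(a)` in `ℂ`.  (H3) **`conj (φ g) = φ (c_G g)`** for every `g`, whenever `φ` is a right-`K`-invariant `χ`-section with
`φ(1) ∈ ℝ`, `G(𝔸) = B(𝔸)·K` (Iwasawa, ★ `exists_mem_borelAdelic_mul_mem_standardMaximalCompactGL_cm` at the CM pair) and `c_G(K) ⊆ K` — the last is the LETTER **(K)** (Galois stability of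
`K_max = K_∞·GL_N(𝒪̂_E)`: `c` permutes places, preserves integrality and the archimedean unitary groups; ★ `ReductionTheoryGLn` :213 currency).  This pays `hreal` of ★
`K2E1ChiScatteringConjSymmetryTubeU2.htube_of_godementScalar` for the M1 sections; `hreal′` is `φ′(1) ∈ ℝ`.
HONEST LABEL: HC_CM is proved only modulo the 7 printed citations (2 remaining named inputs: hLiu418 = `stmt-HodgeConjecture-24832`, h413 = `stmt-HodgeConjecture-24833`) until rung 0
closes; this file asserts no named fact, closes no socket; count-neutral; letter (K) (and the Iwasawa∕right-`K`-invariance binders of the datum).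
[cite: MoeglinWaldspurger1995, I.2.17 and II.1.7] [cite: GelbartRogawski1991, §3.1]

## References
* [MoeglinWaldspurger1995] C. Mœglin, J.-L. Waldspurger, *Spectral decomposition and Eisenstein series* (1995), I.2.17, II.1.7.
* [GelbartRogawski1991] S. Gelbart, J. Rogawski, *L-functions and Fourier–Jacobi coefficients for the unitary group U(3)*, Invent. Math. 105 (1991), §3.1.
-/

set_option autoImplicit false
set_option linter.dupNamespace false  -- the mandated namespace repeats the summit's segment (`HodgeConjecture.HodgeConjecture`)

noncomputable section

open NumberField IsDedekindDomain
open scoped NNReal MatrixGroups ComplexConjugate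
open Literature.NumberTheory.Automorphic Literature.NumberTheory.Automorphic.UnitaryGroup AdelicGroupData
open Literature.NumberTheory.GaloisRepresentations (HeckeCharacter)
open Summit.HodgeConjecture.HodgeConjecture.Cruxes.H413.K2E1BorelEisensteinU
open Summit.HodgeConjecture.HodgeConjecture.Cruxes.H413.K2E1CharacterEisensteinU2Defs
open Summit.HodgeConjecture.HodgeConjecture.Cruxes.H413.K2E1QuasiSplitGaloisTwistU2

namespace Summit.HodgeConjecture.HodgeConjecture.Cruxes.H413.K2E1ChiSectionGaloisTwistU2

variable {F E : Type} [Field F] [NumberField F] [Field E] [NumberField E] [Algebra F E] {c : E ≃ₐ[F] E} {N : ℕ} [NeZero N]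

/-! ## §1 (S1) The first diagonal entry under the twist -/

/-- **(S1) `(c_G b)₀₀ = (c ⊗ 1)(b₀₀)`** as ideles. [cite: GelbartRogawski1991, §3.1] -/
theorem firstEntryUnit_galTwist {cG : (quasiSplit F E c N).Adelic →* (quasiSplit F E c N).Adelic}
    (hcG : ∀ g, adelicVal F E c N _ (cG g) = Matrix.GeneralLinearGroup.map (conjAdele F E c) (adelicVal F E c N _ g))
    {b : (quasiSplit F E c N).Adelic} (hb : b ∈ borelAdelic F E c N) (hb' : cG b ∈ borelAdelic F E c N) :
    firstEntryUnit hb' = Units.map (conjAdele F E c : AdeleRing (𝓞 E) E →+* AdeleRing (𝓞 E) E).toMonoidHom (firstEntryUnit hb) := by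
  apply Units.ext
  rw [coe_firstEntryUnit, Units.coe_map, coe_firstEntryUnit, coe_adelicVal_galTwist hcG, Matrix.map_apply]
  rfl

/-! ## §2 (S2) The twisted equivariance of `φ ∘ c_G`; (S3) self-dual unitary characters -/

/-- **(S2) `φ(c_G(b·g)) = χ((c⊗1)b₀₀)·φ(c_G g)`** for a `χ`-section `φ` and `b ∈ B(𝔸_F)`. [cite: MoeglinWaldspurger1995, I.2.17] -/
theorem apply_galTwist_borel_mul (hc : c * c = 1) {cG : (quasiSplit F E c N).Adelic →* (quasiSplit F E c N).Adelic}
    (hcG : ∀ g, adelicVal F E c N _ (cG g) = Matrix.GeneralLinearGroup.map (conjAdele F E c) (adelicVal F E c N _ g))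
    {χ : HeckeCharacter E} {φ : (quasiSplit F E c N).Adelic → ℂ} (hφ : IsChiSection χ φ)
    {b : (quasiSplit F E c N).Adelic} (hb : b ∈ borelAdelic F E c N) (g : (quasiSplit F E c N).Adelic) :
    φ (cG (b * g)) = ((χ (Units.map (conjAdele F E c : AdeleRing (𝓞 E) E →+* AdeleRing (𝓞 E) E).toMonoidHom (firstEntryUnit hb)) : ℂˣ) : ℂ) * φ (cG g) := by
  have hb' : cG b ∈ borelAdelic F E c N := (galTwist_mem_borelAdelic_iff hc hcG b).2 hb
  rw [map_mul, hφ (cG b) hb' (cG g), firstEntryUnit_galTwist hcG hb hb']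

omit [NumberField F] [NeZero N] in
/-- **(S3) For a SELF-DUAL (`χʷ = χ`) UNITARY `χ`: `χ((c⊗1)a) = conj χ(a)`** in `ℂ` (`χʷ(a) = χ((c⊗1)a)⁻¹`, ★ `reflectChar_apply`; `|χ| = 1` ⇒ inverse = conjugate, Mathlib `Complex.inv_eq_conj`).
[cite: MoeglinWaldspurger1995, II.1.7] -/
theorem apply_units_map_conjAdele_of_selfDual {χ : HeckeCharacter E} (hsd : reflectChar c χ = χ) (hχ : χ.IsUnitary) (a : (AdeleRing (𝓞 E) E)ˣ) :
    ((χ (Units.map (conjAdele F E c : AdeleRing (𝓞 E) E →+* AdeleRing (𝓞 E) E).toMonoidHom a) : ℂˣ) : ℂ) = conj ((χ a : ℂˣ) : ℂ) := by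
  have h := reflectChar_apply (c := c) χ a
  rw [hsd] at h
  -- `χ a = (χ (c a))⁻¹` in `ℂˣ`, so `χ (c a) = (χ a)⁻¹`
  have h2 : χ (Units.map (conjAdele F E c : AdeleRing (𝓞 E) E →+* AdeleRing (𝓞 E) E).toMonoidHom a) = (χ a)⁻¹ := by rw [h, inv_inv]
  rw [h2, Units.val_inv_eq_inv_val, Complex.inv_eq_conj (hχ a)]

/-! ## §3 (H3) The reality `conj ∘ φ = φ ∘ c_G` of a normalised right-`K`-invariant section of a self-dual unitary `χ`, modulo (K) -/

/-- **(H3) `conj (φ g) = φ (c_G g)` FOR EVERY `g`**, for a right-`K`-invariant `χ`-section `φ` with `φ(1) ∈ ℝ` of a SELF-DUAL UNITARY `χ`, given the Iwasawa decomposition `G = B·K` and the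
`K`-stability LETTER **(K)** `c_G(K) ⊆ K`: both sides equal `conj χ(b₀₀)·φ(1)` at `g = b·k` ((S2), (S3)).  Pays `hreal` of ★ `K2E1ChiScatteringConjSymmetryTubeU2.htube_of_godementScalar` at the
M1 datum (`K = K_max`: Iwasawa ★ `exists_mem_borelAdelic_mul_mem_standardMaximalCompactGL_cm`). [cite: MoeglinWaldspurger1995, I.2.17, II.1.7] [cite: GelbartRogawski1991, §3.1] -/
theorem conj_apply_eq_apply_galTwist_of_selfDual (hc : c * c = 1) {cG : (quasiSplit F E c N).Adelic →* (quasiSplit F E c N).Adelic}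
    (hcG : ∀ g, adelicVal F E c N _ (cG g) = Matrix.GeneralLinearGroup.map (conjAdele F E c) (adelicVal F E c N _ g))
    {K : Set (quasiSplit F E c N).Adelic} (hIw : ∀ g : (quasiSplit F E c N).Adelic, ∃ b ∈ borelAdelic F E c N, ∃ k ∈ K, g = b * k) (hK : ∀ k ∈ K, cG k ∈ K)
    {χ : HeckeCharacter E} (hsd : reflectChar c χ = χ) (hχ : χ.IsUnitary)
    {φ : (quasiSplit F E c N).Adelic → ℂ} (hφ : IsChiSection χ φ) (hφK : ∀ k ∈ K, ∀ g, φ (g * k) = φ g) (hφ1 : conj (φ 1) = φ 1) :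
    ∀ g, conj (φ g) = φ (cG g) := by
  intro g
  obtain ⟨b, hb, k, hk, rfl⟩ := hIw g
  have h1 : φ k = φ 1 := by rw [← one_mul k, hφK k hk 1]
  rw [hφ b hb k, map_mul, h1, hφ1, apply_galTwist_borel_mul hc hcG hφ hb k, apply_units_map_conjAdele_of_selfDual hsd hχ]
  congr 1
  rw [← one_mul (cG k), hφK (cG k) (hK k hk) 1]

end Summit.HodgeConjecture.HodgeConjecture.Cruxes.H413.K2E1ChiSectionGaloisTwistU2

end
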